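import Literature.IUT.HodgeTheaters.GlobalFrobenioidsCoricRigidityOfDivisors
import HarnessLib

/-!
# [IUTchI] Example 5.1 (v), pp. 127–128: a kernel CONSEQUENCE of the typed Kummer-rigidity laws — every element of
# `π₁^rat(†𝒟^⊛)` commuting with the action acts TRIVIALLY on `𝕄^⊛_∞κ×(†𝒟^⊚)`; hence the law set of the layer-5
# certificate row `IUTchI:Ex5.1(v)` has NO model with abelian `π₁^rat` (tightness / vacuity datum, proof-only)

S. Mochizuki, *Inter-universal Teichmüller theory I*, kurims manuscript (May 2020), §5 Example 5.1 (v), p. 127 l. 76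
– p. 128 l. 2 ("by considering divisors of zeroes and poles … associated to Kummer classes of rational functions …
`ℚ_{>0} ∩ Ẑ^× = {1}`") and p. 127 l. 30–35 ("the `π₁^rat(†𝒟^⊛)`-action … does not factor through
`π₁^rat(†𝒟^⊛) ↠ π₁^{κ-sol}(†𝒟^⊛)`") ([IUTchI] Ex 5.1 (v) pp.127–128) [claim: Mochizuki2012, status: disputed] (D-0012
claim key; nothing disputed is asserted; no side is taken on [IUTchIII] Cor. 3.12).

Cell abc-iut, sub-DAG `plan/L5/SUBDAG-IUTchI-Ex51.md` rows E51/L23, E51/L29; layer-5 certificate additive module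
`Layer5OfSEx51` (row 1116, theorem `layer5_held_ex51v`), whose law binders for the ∞κ×-pair are
(a) `h_Ex51v_natx` Kummer naturality, (b′) `h_Ex51v_ordx` divisor transport on the `π₁^rat`-fixed functions,
Rmk 3.1.7 `h_Ex51v_zerox` (some fixed function has two zeroes), and `h_Ex51v_moves` (some element of
`π₁^{rat/κ-sol}` MOVES some ∞κ×-coric function).  This file proves, from (a) + (b′) + `zerox` alone:

* `CoricPair.exists_iso_of_comm` — for any pair `Γ ↷ P`, an element `c ∈ Γ` commuting with the action of `Γ` on
  `P` acts on `P` by an AUTOMORPHISM OF THE PAIR (`x ↦ c • x`; the pair axioms `smul_dom`/`smul_op` say exactly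
  that the action respects the partial multiplication);
* **`NFBridgeRecon.smul_eq_self_of_laws_of_comm`** — under (a) + (b′) + `zerox`, such a `c` acts TRIVIALLY on
  `𝕄^⊛_∞κ×(†𝒟^⊚)`: by (a) the automorphism `c • (−)` multiplies Kummer classes by a unit `u ∈ Ẑ^×`; applying (b′) to
  a FIXED function with a zero gives `u(η d) = η d`, `d > 0`, so `u = 1` ("`ℚ_{>0} ∩ Ẑ^× = {1}`",
  `CyclotomeRigidity.eq_one_of_apply_eta_self`), and injectivity of the Kummer map gives `c • f = f`;
* `NFBridgeRecon.smul_eq_self_of_laws_of_mem_center` — in particular the CENTRE of `π₁^rat(†𝒟^⊛)` acts trivially;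
* **`NFBridgeRecon.not_laws_of_comm_of_moves`** — consequently the four binders (a), (b′), `zerox`, `moves` are
  JOINTLY UNSATISFIABLE whenever the mover provided by `moves` commutes with the action — e.g. for every
  interface datum `N` with COMMUTATIVE `π₁^rat(†𝒟^⊛)` (`not_laws_of_commutative`).

READING (honest framing).  This is a TIGHTNESS datum for the certificate's binder list, not a refutation: at the
genuine data `π₁^rat(†𝒟^⊛) = Gal(L̄_C/L_C)` is centre-free (cf. Rmk 3.1.7 (iv) "`Gal(L̄_C/L_C(κ-sol))` is
center-free", FACT-LIST F-1391 `KappaSolGalois.CenterFree`) and the printed movers (elements of `π₁^{rat/κ-sol}`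
moving constants in `F̄ ∖ F_sol`) are far from central, so no contradiction is claimed there; what the theorem
shows is that ANY non-vacuity witness of row 1116's binder set must carry a NON-ABELIAN `π₁^rat`-action on
`𝕄^⊛_∞κ×` (no degenerate/abelian toy can inhabit it), and that the laws (a)+(b′)+Rmk 3.1.7 already ENTAIL the
group-theoretic statement "no action-central element of `π₁^rat` moves an ∞κ×-coric function".
PROOF-ONLY: no definition, no instance, no notation, no new Prop fact.  typed ≠ proved elsewhere.
-/

namespace Literature.IUT.HodgeTheaters

open ProfiniteGrp ProfiniteGrp.ProfiniteCompletion
open Literature.AnabelianGeometry.EtaleTheta Literature.AnabelianGeometry.EtaleTheta.ZHatLevel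

universe u

/-! ### An action-central element acts by an automorphism of the pair -/

section Comm

variable {Γ : Type u} [Group Γ] [TopologicalSpace Γ]

/-- For a pair `Γ ↷ P` and `c ∈ Γ` commuting with the action of every `g ∈ Γ` on `P`, the map `x ↦ c • x` is an
automorphism of the pair (equivariant by the commutation; it respects the partial multiplication by the pair
axioms `smul_dom`, `smul_op`).  Stated as an existence (proof-only file). ([IUTchI] Ex 5.1 (v) p.127)
[claim: Mochizuki2012, status: disputed] -/
theorem CoricPair.exists_iso_of_comm (P : CoricPair Γ) (c : Γ)
    (hc : ∀ (g : Γ) (x : P.carrier), c • g • x = g • c • x) :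
    ∃ e : CoricPair.Iso P P, ∀ x : P.carrier, e.toEquiv x = c • x := by
  refine ⟨{ toEquiv :=
              { toFun := fun x => c • x
                invFun := fun x => c⁻¹ • x
                left_inv := fun x => inv_smul_smul c x
                right_inv := fun x => smul_inv_smul c x }
            smul := fun g x => hc g x
            dom := fun p => P.smul_dom c p
            op := fun p => P.smul_op c p }, fun x => rfl⟩

end Comm

/-! ### The laws force action-central elements to act trivially on `𝕄^⊛_∞κ×(†𝒟^⊚)` -/

namespace NFBridgeRecon

variable (N : NFBridgeRecon.{u})

/-- **Action-central elements are motionless under the Kummer-rigidity laws.**  Let `κx` be a Kummer realisation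
of the model ∞κ×-pair in a container with `Ẑ^×`-action, satisfying (a) naturality `hnatx` and (b′) divisor
transport on the `π₁^rat`-fixed ∞κ×-coric functions `hordx`, and suppose (Rmk 3.1.7) some fixed ∞κ×-coric function
has positive order at some point (`hzerox`, weaker than the certificate's two-zeroes binder).  Then every
`c ∈ π₁^rat(†𝒟^⊛)` commuting with the action on `𝕄^⊛_∞κ×` FIXES every ∞κ×-coric function.
([IUTchI] Ex 5.1 (v) p.127) [claim: Mochizuki2012, status: disputed] -/
theorem smul_eq_self_of_laws_of_comm {H : Type u} [CommGroup H] [MulAction N.piRat H]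
    [MulAction (MulAut (completion (GrpCat.of (Multiplicative ℤ)))) H]
    (κx : N.infκxPair.KummerRealization H)
    (hnatx : ∀ e : CoricPair.Iso N.infκxPair N.infκxPair,
      ∃ u : MulAut (completion (GrpCat.of (Multiplicative ℤ))),
        ∀ x : N.infκxPair.carrier, κx.toFun (e.toEquiv x) = u • κx.toFun x)
    {X : Type*} (ord : X → N.Krat → ℤ)
    (hordx : ∀ (u : MulAut (completion (GrpCat.of (Multiplicative ℤ)))) (f f' : N.infκxPair.carrier),
      (∀ g : N.piRat, g • (f : N.Krat) = f) → (∀ g : N.piRat, g • (f' : N.Krat) = f') →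
      κx.toFun f' = u • κx.toFun f → ∀ x : X, u (eta (ord x f)) = eta (ord x f'))
    (hzerox : ∃ f ∈ N.Minfκx, (∀ g : N.piRat, g • f = f) ∧ ∃ x : X, 0 < ord x f)
    (c : N.piRat) (hc : ∀ (g : N.piRat), ∀ f ∈ N.Minfκx, c • g • f = g • c • f) :
    ∀ f ∈ N.Minfκx, c • f = f := by
  -- `c • (−)` is an automorphism of the ∞κ×-pair
  have hc' : ∀ (g : N.piRat) (x : N.infκxPair.carrier), c • g • x = g • c • x :=
    fun g x => Subtype.ext (hc g (x : N.Krat) x.2)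
  obtain ⟨e, he⟩ := N.infκxPair.exists_iso_of_comm c hc'
  -- by (a) it multiplies Kummer classes by a unit `u`
  obtain ⟨u, hu⟩ := hnatx e
  -- a fixed function `f₀` with a zero: `c` fixes it, so `κx f₀ = u • κx f₀`, and (b′) gives `u (η d) = η d`
  obtain ⟨f₀, hf₀, hfix, x₀, hpos⟩ := hzerox
  have hcf₀ : e.toEquiv ⟨f₀, hf₀⟩ = ⟨f₀, hf₀⟩ := by
    rw [he]
    exact Subtype.ext (hfix c)
  have hκ : κx.toFun ⟨f₀, hf₀⟩ = u • κx.toFun ⟨f₀, hf₀⟩ := by rw [← hu, hcf₀]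
  have hη : u (eta (ord x₀ f₀)) = eta (ord x₀ f₀) := hordx u ⟨f₀, hf₀⟩ ⟨f₀, hf₀⟩ hfix hfix hκ x₀
  -- "`ℚ_{>0} ∩ Ẑ^× = {1}`": `u = 1`
  have hu1 : u = 1 := CyclotomeRigidity.eq_one_of_apply_eta_self u (ne_of_gt hpos) hη
  -- hence `κx (c • f) = κx f`, and the Kummer map is injective
  intro f hf
  have h1 : κx.toFun (e.toEquiv ⟨f, hf⟩) = κx.toFun ⟨f, hf⟩ := by rw [hu, hu1, one_smul]
  have h2 : e.toEquiv ⟨f, hf⟩ = ⟨f, hf⟩ := κx.realizes.injective h1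
  have h3 := congrArg (fun y : N.infκxPair.carrier => (y : N.Krat)) h2
  rw [he] at h3
  exact h3

/-- In particular the CENTRE of `π₁^rat(†𝒟^⊛)` acts trivially on `𝕄^⊛_∞κ×(†𝒟^⊚)` under the laws.
([IUTchI] Ex 5.1 (v) p.127) [claim: Mochizuki2012, status: disputed] -/
theorem smul_eq_self_of_laws_of_mem_center {H : Type u} [CommGroup H] [MulAction N.piRat H]
    [MulAction (MulAut (completion (GrpCat.of (Multiplicative ℤ)))) H]
    (κx : N.infκxPair.KummerRealization H)
    (hnatx : ∀ e : CoricPair.Iso N.infκxPair N.infκxPair,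
      ∃ u : MulAut (completion (GrpCat.of (Multiplicative ℤ))),
        ∀ x : N.infκxPair.carrier, κx.toFun (e.toEquiv x) = u • κx.toFun x)
    {X : Type*} (ord : X → N.Krat → ℤ)
    (hordx : ∀ (u : MulAut (completion (GrpCat.of (Multiplicative ℤ)))) (f f' : N.infκxPair.carrier),
      (∀ g : N.piRat, g • (f : N.Krat) = f) → (∀ g : N.piRat, g • (f' : N.Krat) = f') →
      κx.toFun f' = u • κx.toFun f → ∀ x : X, u (eta (ord x f)) = eta (ord x f'))
    (hzerox : ∃ f ∈ N.Minfκx, (∀ g : N.piRat, g • f = f) ∧ ∃ x : X, 0 < ord x f)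
    {c : N.piRat} (hc : c ∈ Subgroup.center N.piRat) : ∀ f ∈ N.Minfκx, c • f = f := by
  refine N.smul_eq_self_of_laws_of_comm κx hnatx ord hordx hzerox c fun g f _ => ?_
  rw [smul_smul, smul_smul, (Subgroup.mem_center_iff.mp hc g)]

/-- **No model with an action-central mover.**  The binders (a) `hnatx`, (b′) `hordx`, Rmk 3.1.7 `hzerox` (here in
the certificate's two-zeroes form) and `hmoves` of the certificate row `IUTchI:Ex5.1(v)` are jointly
unsatisfiable as soon as the mover supplied by `hmoves` commutes with the action on `𝕄^⊛_∞κ×(†𝒟^⊚)`.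
([IUTchI] Ex 5.1 (v) p.127) [claim: Mochizuki2012, status: disputed] -/
theorem not_laws_of_comm_of_moves {H : Type u} [CommGroup H] [MulAction N.piRat H]
    [MulAction (MulAut (completion (GrpCat.of (Multiplicative ℤ)))) H]
    (κx : N.infκxPair.KummerRealization H)
    (hnatx : ∀ e : CoricPair.Iso N.infκxPair N.infκxPair,
      ∃ u : MulAut (completion (GrpCat.of (Multiplicative ℤ))),
        ∀ x : N.infκxPair.carrier, κx.toFun (e.toEquiv x) = u • κx.toFun x)
    {X : Type*} (ord : X → N.Krat → ℤ)
    (hordx : ∀ (u : MulAut (completion (GrpCat.of (Multiplicative ℤ)))) (f f' : N.infκxPair.carrier),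
      (∀ g : N.piRat, g • (f : N.Krat) = f) → (∀ g : N.piRat, g • (f' : N.Krat) = f') →
      κx.toFun f' = u • κx.toFun f → ∀ x : X, u (eta (ord x f)) = eta (ord x f'))
    (hzerox : ∃ f ∈ N.Minfκx, (∀ g : N.piRat, g • f = f) ∧
      ∃ x₁ x₂ : X, x₁ ≠ x₂ ∧ 0 < ord x₁ f ∧ 0 < ord x₂ f)
    (hmoves : ∃ g ∈ N.ratKsolKer, (∀ (g' : N.piRat), ∀ f ∈ N.Minfκx, g • g' • f = g' • g • f) ∧
      ∃ f ∈ N.Minfκx, g • f ≠ f) : False := by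
  obtain ⟨g, -, hgc, f, hf, hne⟩ := hmoves
  obtain ⟨f₀, hf₀, hfix, x₁, -, -, h₁, -⟩ := hzerox
  exact hne (N.smul_eq_self_of_laws_of_comm κx hnatx ord hordx ⟨f₀, hf₀, hfix, x₁, h₁⟩ g hgc f hf)

/-- **No model over a commutative `π₁^rat(†𝒟^⊛)`.**  For an interface datum `N` whose `π₁^rat` is commutative, the
certificate's binders (a), (b′), Rmk 3.1.7 (two zeroes) and `hmoves` (verbatim) cannot hold together: any
non-vacuity witness of row `IUTchI:Ex5.1(v)` needs a non-abelian `π₁^rat`-action on `𝕄^⊛_∞κ×` — as at the genuine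
data, where `π₁^rat = Gal(L̄_C/L_C)` is centre-free. ([IUTchI] Ex 5.1 (v) p.127) [claim: Mochizuki2012, status: disputed] -/
theorem not_laws_of_commutative (hcomm : ∀ a b : N.piRat, a * b = b * a) {H : Type u} [CommGroup H]
    [MulAction N.piRat H] [MulAction (MulAut (completion (GrpCat.of (Multiplicative ℤ)))) H]
    (κx : N.infκxPair.KummerRealization H)
    (hnatx : ∀ e : CoricPair.Iso N.infκxPair N.infκxPair,
      ∃ u : MulAut (completion (GrpCat.of (Multiplicative ℤ))),
        ∀ x : N.infκxPair.carrier, κx.toFun (e.toEquiv x) = u • κx.toFun x)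
    {X : Type*} (ord : X → N.Krat → ℤ)
    (hordx : ∀ (u : MulAut (completion (GrpCat.of (Multiplicative ℤ)))) (f f' : N.infκxPair.carrier),
      (∀ g : N.piRat, g • (f : N.Krat) = f) → (∀ g : N.piRat, g • (f' : N.Krat) = f') →
      κx.toFun f' = u • κx.toFun f → ∀ x : X, u (eta (ord x f)) = eta (ord x f'))
    (hzerox : ∃ f ∈ N.Minfκx, (∀ g : N.piRat, g • f = f) ∧
      ∃ x₁ x₂ : X, x₁ ≠ x₂ ∧ 0 < ord x₁ f ∧ 0 < ord x₂ f)
    (hmoves : ∃ g ∈ N.ratKsolKer, ∃ f ∈ N.Minfκx, g • f ≠ f) : False := by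
  obtain ⟨g, hg, f, hf, hne⟩ := hmoves
  refine N.not_laws_of_comm_of_moves κx hnatx ord hordx hzerox ⟨g, hg, fun g' f' _ => ?_, f, hf, hne⟩
  rw [smul_smul, smul_smul, hcomm g g']

end NFBridgeRecon

end Literature.IUT.HodgeTheaters
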